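import Mathlib
import Literature.NumberTheory.Sieve.CoprimeSquarefreeSums
import HarnessLib

/-!
# Concrete one-dimensional sieve sums: `Σ μ²/φ`, `Σ μ²/g`, and the tails `Σ μ²/φ²`, `Σ μ²/g²`

Topic `Literature/NumberTheory/Sieve`; sequel of `CoprimeSquarefreeSums.lean`, packaging its general
estimate for the concrete sums appearing in J. Maynard, *Small gaps between primes*, Ann. of Math.
181 (2015), §5 — the quantities `L`, `L_g`, `Z`, `Z_g` of the tree's `MaynardSieveBilinear.lean`
(`abs_S1main_sub_le`, `abs_S2main_sub_le`: errors `y_max² L^k (Z^{k²−k} − 1)`,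
`(y^{(m)}_max)² L_g^{k−1} (Z_g^{k²−k} − 1)`) and `MaynardSieveLemma53.lean` (error `y_max κ k L (Z−1) Z^k`):

* `abs_sum_inv_totient_sub_le` — `L = Σ_{n ≤ B, (n,W)=1} μ²(n)/φ(n)`:
  `|L − (φ(W)/W) log B| ≤ (harmErr W + 4) B(2) + (φ(W)/W) B(2) D₀^{-1/4} log B`
  (the weight `c_p = 1/(p−1)`, `cTot`; Maynard's `Σ_{u<R,(u,W)=1} μ(u)²/φ(u) ≪ φ(W) log R/W`);
* `abs_sum_inv_g_sub_le` — the same for `L_g = Σ μ²(n)/g(n)`, `g(n) = ∏_{p∣n}(p − 2)`, `W` even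
  (`c_p = 2/(p−2)`, `cG`, constant `B(6)`);
* `sum_inv_totient_sq_sub_one_le` — `Z − 1 ≤ 2/(D₀ − 1)`, `Z = Σ_{n ≤ B,(n,W)=1} μ²/φ²` (`D₀ ≥ 2`);
  `sum_inv_g_sq_sub_one_le` — `Z_g − 1 ≤ 2/(D₀ − 2)` (`D₀ ≥ 3`), both through the multiplicative
  majorant `Σ_{n ≤ B} f(n) ≤ ∏_{p ≤ B}(1 + f(p)) ≤ exp(Σ_{D₀<p≤B} 1/(p−a)²) ≤ exp(1/(D₀−a))`
  (`invSqAF`, `sum_invSqAF_le_exp`, `sum_primes_inv_sub_sq_le` from Mathlib's `sum_Ioc_inv_sq_le_sub`);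
* `pow_sub_one_le` — `Z^K − 1 ≤ K (Z − 1) Z^{K−1}`, turning the relative errors above into Maynard's
  `≪ k²/D₀`.

Here every prime `≤ D₀` is assumed to divide `W` (as for `W = ∏_{p ≤ D₀} p`).

## References

* J. Maynard, *Small gaps between primes*, Ann. of Math. (2) 181 (2015), 383–413, displays (5.13),
  (5.20), (5.25), (6.5), (6.15). [cite: MaynardAnnals2015]
-/

open Finset Real ArithmeticFunction

open scoped ArithmeticFunction.Moebius

namespace Literature.NumberTheory.Sieve

namespace SquarefreeSums

/-! ### The weights `μ²/φ` and `μ²/g` as instances of `w_c` -/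

/-- The prime weight of `μ²(n) n/φ(n)`: `c_p = 1/(p − 1)` (`1 + c_p = p/(p−1)`). [folklore] -/
noncomputable def cTot (p : ℕ) : ℝ := 1 / ((p : ℝ) - 1)

/-- The prime weight of `μ²(n) n/g(n)`, `g(p) = p − 2`: `c_p = 2/(p − 2)` for `p ≥ 3` (`1 + c_p = p/(p−2)`),
and `c_2 = 0` (irrelevant: `2 ∣ W` in every application). [folklore] -/
noncomputable def cG (p : ℕ) : ℝ := if p = 2 then 0 else 2 / ((p : ℝ) - 2)

/-- `|c_p| ≤ 2/p` for the `φ`-weight. [folklore] -/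
theorem abs_cTot_le (p : ℕ) (hp : p.Prime) : |cTot p| ≤ 2 / p := by
  have h2 : (2 : ℝ) ≤ p := by exact_mod_cast hp.two_le
  rw [cTot, abs_of_nonneg (by apply div_nonneg zero_le_one; linarith),
    div_le_div_iff₀ (by linarith) (by linarith)]
  linarith

/-- `|c_p| ≤ 6/p` for the `g`-weight. [folklore] -/
theorem abs_cG_le (p : ℕ) (hp : p.Prime) : |cG p| ≤ 6 / p := by
  rw [cG]
  split_ifs with h
  · rw [abs_zero]; positivity
  · have h3 : (3 : ℝ) ≤ p := by
      have := hp.two_le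
      have : 3 ≤ p := by omega
      exact_mod_cast this
    rw [abs_of_nonneg (by apply div_nonneg (by norm_num); linarith),
      div_le_div_iff₀ (by linarith) (by linarith)]
    linarith

/-- For squarefree `n` coprime to `W`: `w_{cTot}(n)/n = 1/φ(n)`. [folklore] -/
theorem wfun_cTot_div {W n : ℕ} (hn : n ≠ 0) (hsq : Squarefree n) (hco : n.Coprime W) :
    wfun W cTot n / n = 1 / (n.totient : ℝ) := by
  rw [wfun_apply_of n hn hsq hco]
  have hφ : (n.totient : ℝ) = ∏ p ∈ n.primeFactors, ((p : ℝ) - 1) := by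
    have h := Nat.totient_eq_prod_factorization hn
    rw [h]
    push_cast
    rw [Finsupp.prod, Nat.support_factorization]
    refine Finset.prod_congr rfl fun p hp => ?_
    have hpp := Nat.prime_of_mem_primeFactors hp
    have h1 : n.factorization p = 1 := by
      have := (Nat.squarefree_iff_factorization_le_one hn).1 hsq p
      have hpos : 0 < n.factorization p := Nat.Prime.factorization_pos_of_dvd hpp hn (Nat.dvd_of_mem_primeFactors hp)
      omega
    rw [h1]
    rw [Nat.cast_sub hpp.one_lt.le]
    simp
  have hnprod : (n : ℝ) = ∏ p ∈ n.primeFactors, (p : ℝ) := by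
    rw [← Nat.cast_prod, Nat.prod_primeFactors_of_squarefree hsq]
  rw [hφ, hnprod, ← Finset.prod_div_distrib, one_div, ← Finset.prod_inv_distrib]
  refine Finset.prod_congr rfl fun p hp => ?_
  have hpp := Nat.prime_of_mem_primeFactors hp
  have h2 : (2 : ℝ) ≤ p := by exact_mod_cast hpp.two_le
  have hp1 : (p : ℝ) - 1 ≠ 0 := by linarith
  rw [cTot]
  field_simp
  ring


/-- For squarefree `n` coprime to an even `W`: `w_{cG}(n)/n = 1/∏_{p∣n}(p − 2)` (`= 1/g(n)`).
[folklore] -/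
theorem wfun_cG_div {W n : ℕ} (hW : 2 ∣ W) (hn : n ≠ 0) (hsq : Squarefree n) (hco : n.Coprime W) :
    wfun W cG n / n = 1 / ∏ p ∈ n.primeFactors, ((p : ℝ) - 2) := by
  rw [wfun_apply_of n hn hsq hco]
  have hnprod : (n : ℝ) = ∏ p ∈ n.primeFactors, (p : ℝ) := by
    rw [← Nat.cast_prod, Nat.prod_primeFactors_of_squarefree hsq]
  rw [hnprod, ← Finset.prod_div_distrib, one_div, ← Finset.prod_inv_distrib]
  refine Finset.prod_congr rfl fun p hp => ?_
  have hpp := Nat.prime_of_mem_primeFactors hp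
  have hp2 : p ≠ 2 := by
    rintro rfl
    have : (2 : ℕ) ∣ Nat.gcd n W := Nat.dvd_gcd (Nat.dvd_of_mem_primeFactors hp) hW
    rw [hco] at this; omega
  have h3 : (3 : ℝ) ≤ p := by
    have := hpp.two_le
    have : 3 ≤ p := by omega
    exact_mod_cast this
  have : (p : ℝ) - 2 ≠ 0 := by linarith
  rw [cG, if_neg hp2]
  field_simp
  ring

/-! ### The sums `L = Σ μ²/φ` and `L_g = Σ μ²/g` (two-sided) -/

/-- **`L = Σ_{n ≤ B, (n,W)=1} μ²(n)/φ(n) = (φ(W)/W) log B + O(…)`**: for `W ≥ 1`, every prime `≤ D₀`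
dividing `W` (`D₀ ≥ 1`) and `B ≥ 1`,
`|L − (φ(W)/W) log B| ≤ (harmErr W + 4) B(2) + (φ(W)/W) B(2) D₀^{-1/4} log B`
(Maynard's `Σ_{u<R,(u,W)=1} μ(u)²/φ(u) ≪ φ(W) log R/W`, (5.13)/(6.5), two-sided). [cite: MaynardAnnals2015, (5.13) and (6.5)] -/
theorem abs_sum_inv_totient_sub_le {W : ℕ} (hW : W ≠ 0) {D₀ : ℕ} (hD0 : 1 ≤ D₀)
    (hD : ∀ p, p.Prime → p ≤ D₀ → p ∣ W) {B : ℕ} (hB : 1 ≤ B) :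
    |∑ n ∈ (Finset.Icc 1 B).filter (fun n => Squarefree n ∧ n.Coprime W), 1 / (n.totient : ℝ) -
        (W.totient : ℝ) / W * Real.log B| ≤
      (harmErr W + 4) * bConst 2 +
        (W.totient : ℝ) / W * (bConst 2 * (D₀ : ℝ) ^ (-(1 : ℝ) / 4)) * Real.log B := by
  have hB1 : (1 : ℝ) ≤ B := by exact_mod_cast hB
  have h1 := abs_sum_wfun_div_sub_le (c := cTot) hW abs_cTot_le hB1
  have h2 := abs_bsum_sub_one_le (W := W) (c := cTot) abs_cTot_le hD0 hD hB1
  rw [Nat.floor_natCast] at h1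
  have hsum : ∑ n ∈ Finset.Icc 1 B, wfun W cTot n / n =
      ∑ n ∈ (Finset.Icc 1 B).filter (fun n => Squarefree n ∧ n.Coprime W), 1 / (n.totient : ℝ) := by
    rw [Finset.sum_filter]
    refine Finset.sum_congr rfl fun n hn => ?_
    have hn0 : n ≠ 0 := by have := (Finset.mem_Icc.1 hn).1; omega
    split_ifs with h
    · exact wfun_cTot_div hn0 h.1 h.2
    · rw [not_and_or] at h
      rcases h with h | h
      · rw [wfun_eq_zero_of_not_squarefree h, zero_div]
      · rw [wfun_eq_zero_of_not_coprime h, zero_div]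
  rw [hsum] at h1
  have hlog : 0 ≤ Real.log B := Real.log_nonneg hB1
  have hA : 0 ≤ (W.totient : ℝ) / W := by positivity
  calc _ = |(∑ n ∈ (Finset.Icc 1 B).filter (fun n => Squarefree n ∧ n.Coprime W), 1 / (n.totient : ℝ) -
            (W.totient : ℝ) / W * bsum W cTot B * Real.log B) +
          (W.totient : ℝ) / W * (bsum W cTot B - 1) * Real.log B| := by ring_nf
    _ ≤ _ := abs_add_le _ _
    _ ≤ _ := by
        refine add_le_add h1 ?_
        rw [abs_mul, abs_mul, abs_of_nonneg hA, abs_of_nonneg hlog]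
        gcongr

/-- **`L_g = Σ_{n ≤ B, (n,W)=1} μ²(n)/g(n) = (φ(W)/W) log B + O(…)`**, `g(n) = ∏_{p∣n}(p−2)`, for even
`W`: the analogue of `abs_sum_inv_totient_sub_le` for Maynard's `Σ_{u<R,(u,W)=1} μ(u)²/g(u)` in (5.20),
(6.15). [cite: MaynardAnnals2015, (5.20) and (6.15)] -/
theorem abs_sum_inv_g_sub_le {W : ℕ} (hW : W ≠ 0) (hW2 : 2 ∣ W) {D₀ : ℕ} (hD0 : 1 ≤ D₀)
    (hD : ∀ p, p.Prime → p ≤ D₀ → p ∣ W) {B : ℕ} (hB : 1 ≤ B) :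
    |∑ n ∈ (Finset.Icc 1 B).filter (fun n => Squarefree n ∧ n.Coprime W),
          1 / ∏ p ∈ n.primeFactors, ((p : ℝ) - 2) -
        (W.totient : ℝ) / W * Real.log B| ≤
      (harmErr W + 4) * bConst 6 +
        (W.totient : ℝ) / W * (bConst 6 * (D₀ : ℝ) ^ (-(1 : ℝ) / 4)) * Real.log B := by
  have hB1 : (1 : ℝ) ≤ B := by exact_mod_cast hB
  have h1 := abs_sum_wfun_div_sub_le (c := cG) hW abs_cG_le hB1
  have h2 := abs_bsum_sub_one_le (W := W) (c := cG) abs_cG_le hD0 hD hB1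
  rw [Nat.floor_natCast] at h1
  have hsum : ∑ n ∈ Finset.Icc 1 B, wfun W cG n / n =
      ∑ n ∈ (Finset.Icc 1 B).filter (fun n => Squarefree n ∧ n.Coprime W),
        1 / ∏ p ∈ n.primeFactors, ((p : ℝ) - 2) := by
    rw [Finset.sum_filter]
    refine Finset.sum_congr rfl fun n hn => ?_
    have hn0 : n ≠ 0 := by have := (Finset.mem_Icc.1 hn).1; omega
    split_ifs with h
    · exact wfun_cG_div hW2 hn0 h.1 h.2
    · rw [not_and_or] at h
      rcases h with h | h
      · rw [wfun_eq_zero_of_not_squarefree h, zero_div]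
      · rw [wfun_eq_zero_of_not_coprime h, zero_div]
  rw [hsum] at h1
  have hlog : 0 ≤ Real.log B := Real.log_nonneg hB1
  have hA : 0 ≤ (W.totient : ℝ) / W := by positivity
  calc _ = |(∑ n ∈ (Finset.Icc 1 B).filter (fun n => Squarefree n ∧ n.Coprime W),
            1 / ∏ p ∈ n.primeFactors, ((p : ℝ) - 2) -
            (W.totient : ℝ) / W * bsum W cG B * Real.log B) +
          (W.totient : ℝ) / W * (bsum W cG B - 1) * Real.log B| := by ring_nf
    _ ≤ _ := abs_add_le _ _
    _ ≤ _ := by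
        refine add_le_add h1 ?_
        rw [abs_mul, abs_mul, abs_of_nonneg hA, abs_of_nonneg hlog]
        gcongr

/-! ### The tails `Z − 1`, `Z_g − 1`: `Σ_{1 < n ≤ B, (n,W)=1} μ²(n)/φ(n)² ≪ 1/D₀` -/

/-- `Σ_{D₀ < p ≤ B, p prime} 1/(p − a)² ≤ 1/(D₀ − a)` for `a + 1 ≤ D₀` (shift of Mathlib's
`sum_Ioc_inv_sq_le_sub`). [folklore] -/
theorem sum_primes_inv_sub_sq_le (a D₀ B : ℕ) (hD : a + 1 ≤ D₀) :
    ∑ p ∈ (Finset.Ioc D₀ B).filter Nat.Prime, 1 / ((p : ℝ) - a) ^ 2 ≤ 1 / ((D₀ : ℝ) - a) := by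
  rcases le_or_gt D₀ B with hDB | hDB
  swap
  · rw [Finset.Ioc_eq_empty (by omega), Finset.filter_empty, Finset.sum_empty]
    have : (a : ℝ) + 1 ≤ D₀ := by exact_mod_cast hD
    exact div_nonneg zero_le_one (by linarith)
  calc ∑ p ∈ (Finset.Ioc D₀ B).filter Nat.Prime, 1 / ((p : ℝ) - a) ^ 2
      ≤ ∑ p ∈ Finset.Ioc D₀ B, 1 / ((p : ℝ) - a) ^ 2 :=
        Finset.sum_le_sum_of_subset_of_nonneg (Finset.filter_subset _ _) fun _ _ _ => by positivity
    _ = ∑ i ∈ Finset.Ioc (D₀ - a) (B - a), (((i : ℕ) : ℝ) ^ 2)⁻¹ := by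
        have hset : Finset.Ioc D₀ B = (Finset.Ioc (D₀ - a) (B - a)).map (addRightEmbedding a) := by
          rw [Finset.map_add_right_Ioc]
          congr 1 <;> omega
        rw [hset, Finset.sum_map]
        refine Finset.sum_congr rfl fun i _ => ?_
        simp [one_div]
    _ ≤ ((D₀ - a : ℕ) : ℝ)⁻¹ - ((B - a : ℕ) : ℝ)⁻¹ :=
        sum_Ioc_inv_sq_le_sub (α := ℝ) (by omega) (by omega)
    _ ≤ 1 / ((D₀ : ℝ) - a) := by
        rw [Nat.cast_sub (by omega), one_div]
        have : 0 ≤ ((B - a : ℕ) : ℝ)⁻¹ := by positivity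
        linarith

/-- The squarefree-coprime indicator weighted by `1/(∏_{p∣n}(p − a))²` as a multiplicative arithmetic
function (`a = 1`: `1/φ(n)²`; `a = 2`: `1/g(n)²`). [folklore] -/
noncomputable def invSqAF (W a : ℕ) : ArithmeticFunction ℝ :=
  ⟨fun n => if n ≠ 0 ∧ Squarefree n ∧ n.Coprime W then 1 / (∏ p ∈ n.primeFactors, ((p : ℝ) - a)) ^ 2
    else 0, by simp⟩

/-- Unfolding `invSqAF`. [folklore] -/
theorem invSqAF_apply (W a n : ℕ) : invSqAF W a n =
    if n ≠ 0 ∧ Squarefree n ∧ n.Coprime W then 1 / (∏ p ∈ n.primeFactors, ((p : ℝ) - a)) ^ 2 else 0 := rfl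

/-- `invSqAF` is multiplicative. [folklore] -/
theorem isMultiplicative_invSqAF (W a : ℕ) : (invSqAF W a).IsMultiplicative := by
  refine IsMultiplicative.iff_ne_zero.2 ⟨?_, ?_⟩
  · rw [invSqAF_apply, if_pos ⟨one_ne_zero, squarefree_one, Nat.coprime_one_left W⟩]; simp
  · intro m n hm hn hmn
    simp only [invSqAF_apply]
    by_cases hsq : Squarefree (m * n)
    · have hsqm : Squarefree m := (Nat.squarefree_mul_iff.1 hsq).2.1
      have hsqn : Squarefree n := (Nat.squarefree_mul_iff.1 hsq).2.2
      by_cases hco : (m * n).Coprime W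
      · obtain ⟨h1, h2⟩ := Nat.coprime_mul_iff_left.1 hco
        rw [if_pos ⟨Nat.mul_ne_zero hm hn, hsq, hco⟩, if_pos ⟨hm, hsqm, h1⟩, if_pos ⟨hn, hsqn, h2⟩,
          Nat.Coprime.primeFactors_mul hmn, Finset.prod_union hmn.disjoint_primeFactors]
        rw [mul_pow, one_div_mul_one_div]
      · rw [if_neg (fun h => hco h.2.2)]
        rw [Nat.coprime_mul_iff_left, not_and_or] at hco
        rcases hco with h | h
        · rw [if_neg (fun h' => h h'.2.2), zero_mul]
        · rw [if_neg (fun h' : n ≠ 0 ∧ Squarefree n ∧ n.Coprime W => h h'.2.2), mul_zero]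
    · rw [if_neg (fun h => hsq h.2.1)]
      rw [Nat.squarefree_mul_iff, not_and_or, not_and_or] at hsq
      rcases hsq with h | h | h
      · exact absurd hmn h
      · rw [if_neg (fun h' => h h'.2.1), zero_mul]
      · rw [if_neg (fun h' : n ≠ 0 ∧ Squarefree n ∧ n.Coprime W => h h'.2.1), mul_zero]

/-- `invSqAF ≥ 0` (it is the inverse of a square). [folklore] -/
theorem invSqAF_nonneg (W a n : ℕ) : 0 ≤ invSqAF W a n := by
  rw [invSqAF_apply]; split_ifs <;> positivity

/-- **Tail bound**: if every prime `≤ D₀` divides `W` and `a + 1 ≤ D₀`, then for every `B`,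
`Σ_{n ≤ B, (n,W)=1} μ²(n)/(∏_{p∣n}(p−a))² ≤ exp(1/(D₀ − a))`; the term `n = 1` is `1`, so the sum over
`n > 1` (all of whose prime factors exceed `D₀`) is `≤ exp(1/(D₀−a)) − 1 ≤ 2/(D₀ − a)` — Maynard's
`Σ_{s>D₀} μ(s)²/φ(s)² ≪ 1/D₀` ((5.13)) and `Σ_{s>D₀} μ(s)²/g(s)² ≪ 1/D₀` ((5.25)).
[cite: MaynardAnnals2015, (5.13) and (5.25)] -/
theorem sum_invSqAF_le_exp {W a D₀ : ℕ} (hD : a + 1 ≤ D₀) (hDW : ∀ p, p.Prime → p ≤ D₀ → p ∣ W)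
    (B : ℕ) :
    ∑ n ∈ Finset.Icc 1 B, invSqAF W a n ≤ Real.exp (1 / ((D₀ : ℝ) - a)) := by
  have step1 := sum_le_prod_sum_prime_pow (isMultiplicative_invSqAF W a) (invSqAF_nonneg W a) B
  refine step1.trans ?_
  -- local factors: `1 + [p ∤ W]/(p − a)²`
  have hloc : ∀ p ∈ Nat.primesBelow (B + 1), ∑ j ∈ Finset.range (B + 1), invSqAF W a (p ^ j) ≤
      1 + (if D₀ < p then 1 / ((p : ℝ) - a) ^ 2 else 0) := by
    intro p hp
    have hpp := (Nat.mem_primesBelow.1 hp).2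
    -- only `j = 0, 1` contribute
    have hvan : ∀ j ∈ Finset.range (B + 1), ¬j < 2 → invSqAF W a (p ^ j) = 0 := by
      intro j _ hj
      rw [invSqAF_apply, if_neg]
      rintro ⟨-, hsq, -⟩
      rcases Squarefree.eq_zero_or_one_of_pow_of_not_isUnit hsq hpp.not_isUnit with h | h <;> omega
    rw [← Finset.sum_filter_of_ne (p := fun j => j < 2) (fun j hj hne => by
      by_contra h; exact hne (hvan j hj h))]
    have hsub : (Finset.range (B + 1)).filter (fun j => j < 2) ⊆ Finset.range 2 := by
      intro j hj; simp only [Finset.mem_filter, Finset.mem_range] at hj ⊢; exact hj.2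
    refine (Finset.sum_le_sum_of_subset_of_nonneg hsub fun _ _ _ => invSqAF_nonneg _ _ _).trans ?_
    rw [Finset.sum_range_succ, Finset.sum_range_succ, Finset.sum_range_zero, zero_add, pow_zero,
      (isMultiplicative_invSqAF W a).map_one, pow_one]
    gcongr
    rw [invSqAF_apply]
    split_ifs with h1 h2 h2
    · rw [hpp.primeFactors, Finset.prod_singleton]
    · -- `p ∤ W`... but `p ≤ D₀` would force `p ∣ W`
      exfalso
      have hle : p ≤ D₀ := not_lt.1 h2
      exact hpp.ne_one (Nat.Coprime.eq_one_of_dvd h1.2.2 (hDW p hpp hle))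
    · positivity
    · rfl
  calc ∏ p ∈ Nat.primesBelow (B + 1), ∑ j ∈ Finset.range (B + 1), invSqAF W a (p ^ j)
      ≤ ∏ p ∈ Nat.primesBelow (B + 1), (1 + (if D₀ < p then 1 / ((p : ℝ) - a) ^ 2 else 0)) :=
        Finset.prod_le_prod (fun p _ => Finset.sum_nonneg fun _ _ => invSqAF_nonneg _ _ _) hloc
    _ ≤ Real.exp (∑ p ∈ Nat.primesBelow (B + 1), (if D₀ < p then 1 / ((p : ℝ) - a) ^ 2 else 0)) :=
        prod_one_add_le_exp_sum fun p _ => by split_ifs <;> positivity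
    _ ≤ Real.exp (1 / ((D₀ : ℝ) - a)) := by
        rw [Real.exp_le_exp, ← Finset.sum_filter]
        refine le_trans (le_of_eq ?_) (sum_primes_inv_sub_sq_le a D₀ B hD)
        refine Finset.sum_congr ?_ fun _ _ => rfl
        ext p
        simp only [Finset.mem_filter, Nat.mem_primesBelow, Finset.mem_Ioc]
        constructor
        · rintro ⟨⟨h1, h2⟩, h3⟩; exact ⟨⟨h3, by omega⟩, h2⟩
        · rintro ⟨⟨h1, h2⟩, h3⟩; exact ⟨⟨by omega, h3⟩, h1⟩

/-- `e^x − 1 ≤ 2x` for `0 ≤ x ≤ 1`. [folklore] -/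
theorem exp_sub_one_le_two_mul {x : ℝ} (h0 : 0 ≤ x) (h1 : x ≤ 1) : Real.exp x - 1 ≤ 2 * x := by
  have := Real.add_one_le_exp x
  have hx2 : Real.exp x ≤ 1 + x + x ^ 2 := by
    have := Real.exp_bound' h0 h1 (n := 2) zero_lt_two
    simp only [Finset.sum_range_succ, Finset.sum_range_zero, pow_zero, Nat.factorial_zero, Nat.cast_one,
      div_one, pow_one, Nat.factorial_one, zero_add, Nat.factorial_two, Nat.cast_ofNat] at this
    nlinarith
  nlinarith

/-- `Z^K − 1 ≤ K (Z − 1) Z^{K−1}` for `Z ≥ 1` (the step turning the relative error `Z_ρ^{k²−k} − 1` of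
`MaynardSieveBilinear.abs_bilinear_sub_diag_le` into Maynard's `≪ k²/D₀`). [folklore] -/
theorem pow_sub_one_le {Z : ℝ} (hZ : 1 ≤ Z) (K : ℕ) : Z ^ K - 1 ≤ K * (Z - 1) * Z ^ (K - 1) := by
  have h := geom_sum_mul Z K
  rw [← h]
  have hgeom : ∑ i ∈ Finset.range K, Z ^ i ≤ K * Z ^ (K - 1) := by
    calc ∑ i ∈ Finset.range K, Z ^ i ≤ ∑ _i ∈ Finset.range K, Z ^ (K - 1) :=
          Finset.sum_le_sum fun i hi => pow_le_pow_right₀ hZ (by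
            have := Finset.mem_range.1 hi; omega)
      _ = K * Z ^ (K - 1) := by rw [Finset.sum_const, Finset.card_range, nsmul_eq_mul]
  have hZ1 : 0 ≤ Z - 1 := by linarith
  nlinarith [hgeom, pow_nonneg (by linarith : (0:ℝ) ≤ Z) (K - 1)]


/-- The tail in the form used downstream: `(Σ_{n ≤ B} invSqAF W a n) − 1 ≤ 2/(D₀ − a)`. [folklore] -/
theorem sum_invSqAF_sub_one_le {W a D₀ : ℕ} (hD : a + 1 ≤ D₀) (hDW : ∀ p, p.Prime → p ≤ D₀ → p ∣ W)
    (B : ℕ) :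
    ∑ n ∈ Finset.Icc 1 B, invSqAF W a n - 1 ≤ 2 / ((D₀ : ℝ) - a) := by
  have h := sum_invSqAF_le_exp hD hDW B
  have hDa : (1 : ℝ) ≤ (D₀ : ℝ) - a := by
    have : ((a + 1 : ℕ) : ℝ) ≤ D₀ := by exact_mod_cast hD
    push_cast at this; linarith
  have hx0 : 0 ≤ 1 / ((D₀ : ℝ) - a) := by positivity
  have hx1 : 1 / ((D₀ : ℝ) - a) ≤ 1 := by rw [div_le_one (by linarith)]; exact hDa
  have := exp_sub_one_le_two_mul hx0 hx1
  calc ∑ n ∈ Finset.Icc 1 B, invSqAF W a n - 1 ≤ Real.exp (1 / ((D₀ : ℝ) - a)) - 1 := by linarith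
    _ ≤ 2 * (1 / ((D₀ : ℝ) - a)) := this
    _ = 2 / ((D₀ : ℝ) - a) := by ring

/-- For squarefree `n`: `(∏_{p∣n}(p − 1))² = φ(n)²`, so `invSqAF W 1 n = μ²(n)𝟙_W(n)/φ(n)²`. [folklore] -/
theorem invSqAF_one_eq {W n : ℕ} (hn : n ≠ 0) (hsq : Squarefree n) (hco : n.Coprime W) :
    invSqAF W 1 n = 1 / (n.totient : ℝ) ^ 2 := by
  rw [invSqAF_apply, if_pos ⟨hn, hsq, hco⟩]
  congr 2
  have h := Nat.totient_eq_prod_factorization hn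
  rw [h]
  push_cast
  rw [Finsupp.prod, Nat.support_factorization]
  refine Finset.prod_congr rfl fun p hp => ?_
  have hpp := Nat.prime_of_mem_primeFactors hp
  have h1 : n.factorization p = 1 := by
    have := (Nat.squarefree_iff_factorization_le_one hn).1 hsq p
    have hpos : 0 < n.factorization p :=
      Nat.Prime.factorization_pos_of_dvd hpp hn (Nat.dvd_of_mem_primeFactors hp)
    omega
  rw [h1, Nat.cast_sub hpp.one_lt.le]
  simp

/-- **`Z − 1 ≤ 2/(D₀ − 1)`** for `Z = Σ_{n ≤ B, (n,W)=1} μ²(n)/φ(n)²` when every prime `≤ D₀` divides `W`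
(`D₀ ≥ 2`). [cite: MaynardAnnals2015, (5.13)] -/
theorem sum_inv_totient_sq_sub_one_le {W D₀ : ℕ} (hD : 2 ≤ D₀) (hDW : ∀ p, p.Prime → p ≤ D₀ → p ∣ W)
    (B : ℕ) :
    ∑ n ∈ (Finset.Icc 1 B).filter (fun n => Squarefree n ∧ n.Coprime W), 1 / (n.totient : ℝ) ^ 2 - 1 ≤
      2 / ((D₀ : ℝ) - 1) := by
  have h := sum_invSqAF_sub_one_le (W := W) (a := 1) (D₀ := D₀) (by omega) hDW B
  have hsum : ∑ n ∈ Finset.Icc 1 B, invSqAF W 1 n =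
      ∑ n ∈ (Finset.Icc 1 B).filter (fun n => Squarefree n ∧ n.Coprime W), 1 / (n.totient : ℝ) ^ 2 := by
    rw [Finset.sum_filter]
    refine Finset.sum_congr rfl fun n hn => ?_
    have hn0 : n ≠ 0 := by have := (Finset.mem_Icc.1 hn).1; omega
    split_ifs with h'
    · exact invSqAF_one_eq hn0 h'.1 h'.2
    · rw [invSqAF_apply, if_neg (fun h'' => h' h''.2)]
  rw [hsum] at h
  push_cast at h
  simpa using h

/-- **`Z_g − 1 ≤ 2/(D₀ − 2)`** for `Z_g = Σ_{n ≤ B, (n,W)=1} μ²(n)/g(n)²`, `g(n) = ∏_{p∣n}(p−2)`, when every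
prime `≤ D₀` divides `W` (`D₀ ≥ 3`). [cite: MaynardAnnals2015, (5.25)] -/
theorem sum_inv_g_sq_sub_one_le {W D₀ : ℕ} (hD : 3 ≤ D₀) (hDW : ∀ p, p.Prime → p ≤ D₀ → p ∣ W)
    (B : ℕ) :
    ∑ n ∈ (Finset.Icc 1 B).filter (fun n => Squarefree n ∧ n.Coprime W),
        1 / (∏ p ∈ n.primeFactors, ((p : ℝ) - 2)) ^ 2 - 1 ≤ 2 / ((D₀ : ℝ) - 2) := by
  have h := sum_invSqAF_sub_one_le (W := W) (a := 2) (D₀ := D₀) (by omega) hDW B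
  have hsum : ∑ n ∈ Finset.Icc 1 B, invSqAF W 2 n =
      ∑ n ∈ (Finset.Icc 1 B).filter (fun n => Squarefree n ∧ n.Coprime W),
        1 / (∏ p ∈ n.primeFactors, ((p : ℝ) - 2)) ^ 2 := by
    rw [Finset.sum_filter]
    refine Finset.sum_congr rfl fun n hn => ?_
    have hn0 : n ≠ 0 := by have := (Finset.mem_Icc.1 hn).1; omega
    split_ifs with h'
    · rw [invSqAF_apply, if_pos ⟨hn0, h'.1, h'.2⟩]; push_cast; rfl
    · rw [invSqAF_apply, if_neg (fun h'' => h' h''.2)]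
  rw [hsum] at h
  push_cast at h
  exact h

end SquarefreeSums

end Literature.NumberTheory.Sieve
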